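import Literature.AnabelianGeometry.SemiGraphs.Temperoids
import Literature.AlgebraicGeometry.Frobenioids.QuasiTemperoidConnected
import HarnessLib

/-!
# [SemiAnbd] Remark 3.1.3 (first sentence): the Galois objects of `B^temp(Π)` are the `Π/N` — proof

Mochizuki, *Semi-graphs of anabelioids*, Publ. RIMS **42** (2006) 221–322, §3, manuscript p. 34,
Remark 3.1.3 [cite: MochizukiSemiAnbd2006, Rmk 3.1.3 p.34].  Proof-only companion (no definitions)
of `Literature.AnabelianGeometry.SemiGraphs.Temperoids` (seat abc-iut-L3-t2), discharging AS TYPED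
the named fact `GaloisObjIffQuotientOpenNormal`: "Suppose that `Π` is tempered. Then an object of
`B^temp(Π)` is Galois if and only if it is isomorphic to the object determined by a `Π`-set of the
form `Π/N`, where `N ⊆ Π` is an open normal subgroup."  (The second sentence of the Remark, the
torsor characterisation `GaloisObjIffTorsor`, is the sibling file `TemperoidsGaloisTorsorProofs.lean`.)

Method (abc-iut node `SemiAnbd:Rmk3.1.3`, discharge wave 3): the description of the connected
objects of `B^temp(Π)` as the nonempty single `Π`-orbits, landed in
`Literature.AlgebraicGeometry.Frobenioids.QuasiTemperoidConnected` (`isConnectedObj_iff`,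
`hom_eq_of_apply_eq`, `exists_hom_of_stabilizer_le`), reduces everything to stabilisers: a single
orbit with base point `x₀` is `Π/Stab(x₀)` with `Stab(x₀)` open; the Galois condition of
Definition 3.1 (iv), tested against the connected object `Π/(H ∩ gHg⁻¹)` and the two maps `1 ↦ x₀`,
`1 ↦ g·x₀`, forces `H = Stab(x₀)` to be normal; conversely on `Π/N` the right translations
`xN ↦ xcN` are `Π`-automorphisms moving any point to any other.  Plain topological group theory; no
statement of the paper is strengthened and nothing here concerns the disputed parts of the corpus.
-/

open CategoryTheory CategoryTheory.Limits Topology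

namespace Literature.AnabelianGeometry.SemiGraphs

open Literature.AlgebraicGeometry.Frobenioids (IsConnectedObj IsNonemptyObj)
open Literature.AlgebraicGeometry.Frobenioids.QuasiTemperoid.BTempConnected

universe u

namespace GaloisObjects

variable {G : Type u} [Group G] [TopologicalSpace G]

/-! ### Elementary plumbing in `B^temp(Π)` -/

/-- Identities of `B^temp(Π)` act as the identity on points. [cite: MochizukiSemiAnbd2006, Rmk 3.1.3 p.34] -/
theorem id_apply (X : BTemp G) (x : X.obj.V) : ((𝟙 X : X ⟶ X).hom.hom x : X.obj.V) = x := rfl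

/-- Composites of `B^temp(Π)` act as composites on points. [cite: MochizukiSemiAnbd2006, Rmk 3.1.3 p.34] -/
theorem comp_apply {X Y Z : BTemp G} (f : X ⟶ Y) (g : Y ⟶ Z) (x : X.obj.V) :
    ((f ≫ g).hom.hom x : Z.obj.V) = g.hom.hom (f.hom.hom x) := rfl

/-- `e.inv (e.hom x) = x` for an isomorphism of `B^temp(Π)`. [cite: MochizukiSemiAnbd2006, Rmk 3.1.3 p.34] -/
theorem iso_inv_hom_apply {X Y : BTemp G} (e : X ≅ Y) (x : X.obj.V) :
    (e.inv.hom.hom (e.hom.hom.hom x) : X.obj.V) = x := by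
  rw [← comp_apply, e.hom_inv_id, id_apply]

/-- `e.hom (e.inv y) = y` for an isomorphism of `B^temp(Π)`. [cite: MochizukiSemiAnbd2006, Rmk 3.1.3 p.34] -/
theorem iso_hom_inv_apply {X Y : BTemp G} (e : X ≅ Y) (y : Y.obj.V) :
    (e.hom.hom.hom (e.inv.hom.hom y) : Y.obj.V) = y := by
  rw [← comp_apply, e.inv_hom_id, id_apply]

/-- Connectedness (= being a single nonempty orbit) is invariant under isomorphism in `B^temp(Π)`.
[cite: MochizukiSemiAnbd2006, Rmk 3.1.3 p.34] -/
theorem isConnectedObj_of_iso {X Y : BTemp G} (e : X ≅ Y) (hY : IsConnectedObj Y) :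
    IsConnectedObj X := by
  rw [isConnectedObj_iff] at hY ⊢
  obtain ⟨⟨y⟩, htr⟩ := hY
  refine ⟨⟨e.inv.hom.hom y⟩, fun x₀ x => ?_⟩
  obtain ⟨g, hg⟩ := htr (e.hom.hom.hom x₀) (e.hom.hom.hom x)
  refine ⟨g, ?_⟩
  have h1 := congrArg (fun z : Y.obj.V => (e.inv.hom.hom z : X.obj.V)) hg
  simp only at h1
  rwa [← hom_ρ, iso_inv_hom_apply, iso_inv_hom_apply] at h1

/-! ### The objects `Π/H` -/

variable [IsTopologicalGroup G]

/-- The action on `Π/H`: `k · (aH) = (ka)H`. [cite: MochizukiSemiAnbd2006, Rmk 3.1.2 p.33] -/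
theorem quotientObj_ρ_mk (hG : IsTempered G) (H : Subgroup G) (hH : IsOpen (H : Set G))
    (k a : G) :
    (BTemp.quotientObj G hG H hH).obj.ρ k (a : G ⧸ H) = ((k * a : G) : G ⧸ H) := by
  change k • (a : G ⧸ H) = _
  rw [MulAction.Quotient.smul_mk, smul_eq_mul]

/-- The action on the base point of `Π/H`: `k · H = kH`. [cite: MochizukiSemiAnbd2006, Rmk 3.1.2 p.33] -/
theorem quotientObj_ρ_one (hG : IsTempered G) (H : Subgroup G) (hH : IsOpen (H : Set G)) (k : G) :
    (BTemp.quotientObj G hG H hH).obj.ρ k ((1 : G) : G ⧸ H) = (k : G ⧸ H) := by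
  rw [quotientObj_ρ_mk, mul_one]

/-- `Π/H` is a single orbit through its base point. [cite: MochizukiSemiAnbd2006, Rmk 3.1.2 p.33] -/
theorem quotientObj_transitive (hG : IsTempered G) (H : Subgroup G) (hH : IsOpen (H : Set G))
    (q : (BTemp.quotientObj G hG H hH).obj.V) :
    ∃ g : G, (BTemp.quotientObj G hG H hH).obj.ρ g ((1 : G) : G ⧸ H) = q := by
  obtain ⟨g, rfl⟩ := QuotientGroup.mk_surjective q
  exact ⟨g, quotientObj_ρ_one hG H hH g⟩

/-- The stabiliser of the base point of `Π/H` is `H`. [cite: MochizukiSemiAnbd2006, Rmk 3.1.2 p.33] -/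
theorem quotientObj_ρ_one_eq_iff (hG : IsTempered G) (H : Subgroup G) (hH : IsOpen (H : Set G))
    (k : G) :
    (BTemp.quotientObj G hG H hH).obj.ρ k ((1 : G) : G ⧸ H) = ((1 : G) : G ⧸ H) ↔ k ∈ H := by
  rw [quotientObj_ρ_one]
  change (k : G ⧸ H) = ((1 : G) : G ⧸ H) ↔ k ∈ H
  rw [QuotientGroup.eq, mul_one, inv_mem_iff]

/-- `Π/H` is a connected object of `B^temp(Π)`. [cite: MochizukiSemiAnbd2006, Rmk 3.1.3 p.34] -/
theorem isConnectedObj_quotientObj (hG : IsTempered G) (H : Subgroup G) (hH : IsOpen (H : Set G)) :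
    IsConnectedObj (BTemp.quotientObj G hG H hH) :=
  isConnectedObj_of_transitive _ ((1 : G) : G ⧸ H) (quotientObj_transitive hG H hH)

/-- Maps out of `Π/H`: if `H` fixes `x ∈ X`, there is a morphism `Π/H → X` with `H ↦ x`.
[cite: MochizukiSemiAnbd2006, Rmk 3.1.2 p.33] -/
theorem exists_hom_quotientObj (hG : IsTempered G) (H : Subgroup G) (hH : IsOpen (H : Set G))
    {X : BTemp G} (x : X.obj.V) (hx : ∀ k ∈ H, X.obj.ρ k x = x) :
    ∃ f : BTemp.quotientObj G hG H hH ⟶ X, (f.hom.hom ((1 : G) : G ⧸ H) : X.obj.V) = x :=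
  exists_hom_of_stabilizer_le _ (quotientObj_transitive hG H hH) x fun k hk =>
    hx k ((quotientObj_ρ_one_eq_iff hG H hH k).mp hk)

/-- For `N` normal and `c ∈ Π`, the right translation `xN ↦ xcN` is an automorphism of `Π/N` in
`B^temp(Π)` sending the base point to `cN`. [cite: MochizukiSemiAnbd2006, Rmk 3.1.3 p.34] -/
theorem exists_aut_quotientObj (hG : IsTempered G) (N : Subgroup G) [hN : N.Normal]
    (hNo : IsOpen (N : Set G)) (c : G) :
    ∃ τ : BTemp.quotientObj G hG N hNo ≅ BTemp.quotientObj G hG N hNo,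
      (τ.hom.hom.hom ((1 : G) : G ⧸ N) : G ⧸ N) = (c : G ⧸ N) := by
  -- the translations by `c` and by `c⁻¹`
  have key : ∀ c : G, ∃ f : BTemp.quotientObj G hG N hNo ⟶ BTemp.quotientObj G hG N hNo,
      (f.hom.hom ((1 : G) : G ⧸ N) : G ⧸ N) = (c : G ⧸ N) := by
    intro c
    refine exists_hom_quotientObj hG N hNo (X := BTemp.quotientObj G hG N hNo) (c : G ⧸ N) ?_
    intro k hk
    rw [quotientObj_ρ_mk]
    change ((k * c : G) : G ⧸ N) = (c : G ⧸ N)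
    rw [QuotientGroup.eq, mul_inv_rev]
    exact hN.conj_mem' _ (inv_mem hk) c
  obtain ⟨f, hf⟩ := key c
  obtain ⟨f', hf'⟩ := key c⁻¹
  have hQ := isConnectedObj_quotientObj hG N hNo
  have h1 : f ≫ f' = 𝟙 _ := by
    refine hom_eq_of_apply_eq hQ _ _ ((1 : G) : G ⧸ N) ?_
    rw [comp_apply, id_apply, hf, ← quotientObj_ρ_one hG N hNo c, hom_ρ, hf', quotientObj_ρ_mk,
      mul_inv_cancel]
  have h2 : f' ≫ f = 𝟙 _ := by
    refine hom_eq_of_apply_eq hQ _ _ ((1 : G) : G ⧸ N) ?_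
    rw [comp_apply, id_apply, hf', ← quotientObj_ρ_one hG N hNo c⁻¹, hom_ρ, hf, quotientObj_ρ_mk,
      inv_mul_cancel]
  exact ⟨⟨f, f', h1, h2⟩, hf⟩

/-! ### Remark 3.1.3, first sentence -/

/-- A Galois object of `B^temp(Π)` (`Π` tempered) is isomorphic to some `Π/N`, `N` open normal: it is
the orbit `Π/H` of any of its points, `H = Stab(x₀)` open, and the Galois condition applied to the two
maps `Π/(H ∩ gHg⁻¹) → X`, `1 ↦ x₀` and `1 ↦ g·x₀`, yields an automorphism `α` with `α(g·x₀) = x₀`,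
whence `gHg⁻¹ = Stab(g·x₀) ⊆ Stab(α(g·x₀)) = H`. [cite: MochizukiSemiAnbd2006, Rmk 3.1.3 p.34] -/
theorem exists_iso_quotientObj_of_isGaloisObj (hG : IsTempered G) (X : BTemp G)
    (hX : IsGaloisObj X) :
    ∃ N : OpenNormalSubgroup G, Nonempty (X ≅ BTemp.quotientObj G hG N.toSubgroup N.isOpen') := by
  classical
  obtain ⟨hconn, hgal⟩ := hX
  obtain ⟨⟨x₀⟩, htr⟩ := (isConnectedObj_iff X).mp hconn
  -- the stabiliser of `x₀`
  let H : Subgroup G :=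
    { carrier := {g : G | X.obj.ρ g x₀ = x₀}
      mul_mem' := fun {a b} ha hb => by
        change X.obj.ρ (a * b) x₀ = x₀
        rw [ρ_mul_apply, hb, ha]
      one_mem' := ρ_one_apply X x₀
      inv_mem' := fun {a} ha => by
        change X.obj.ρ a⁻¹ x₀ = x₀
        conv_lhs => rw [← ha]
        exact ρ_inv_apply X a x₀ }
  have hHmem : ∀ g : G, g ∈ H ↔ X.obj.ρ g x₀ = x₀ := fun g => Iff.rfl
  have hHopen : IsOpen (H : Set G) := X.property.2 x₀
  -- normality from the Galois condition
  have hnormal : H.Normal := by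
    refine ⟨fun n hn g => ?_⟩
    -- `K = H ∩ g H g⁻¹`, an open subgroup
    let K : Subgroup G := H ⊓ H.comap (MulAut.conj g⁻¹).toMonoidHom
    have hKmem : ∀ k : G, k ∈ K ↔ X.obj.ρ k x₀ = x₀ ∧ X.obj.ρ (g⁻¹ * k * g) x₀ = x₀ := by
      intro k
      rw [Subgroup.mem_inf, Subgroup.mem_comap, MulEquiv.coe_toMonoidHom, MulAut.conj_apply, inv_inv]
      rfl
    have hKopen : IsOpen (K : Set G) := by
      have : (K : Set G) = (H : Set G) ∩ (fun k : G => g⁻¹ * k * g) ⁻¹' (H : Set G) := by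
        ext k
        rw [SetLike.mem_coe, hKmem]
        rfl
      rw [this]
      exact hHopen.inter (hHopen.preimage (by fun_prop))
    let S : BTemp G := BTemp.quotientObj G hG K hKopen
    have hS : IsConnectedObj S := isConnectedObj_quotientObj hG K hKopen
    -- `ψ₁ : 1 ↦ x₀`, `ψ₂ : 1 ↦ g·x₀`
    obtain ⟨ψ₁, hψ₁⟩ := exists_hom_quotientObj hG K hKopen (X := X) x₀ fun k hk => ((hKmem k).mp hk).1
    obtain ⟨ψ₂, hψ₂⟩ := exists_hom_quotientObj hG K hKopen (X := X) (X.obj.ρ g x₀) fun k hk => by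
      have h2 := ((hKmem k).mp hk).2
      have := congrArg (X.obj.ρ g) h2
      rwa [← ρ_mul_apply, ← mul_assoc, ← mul_assoc, mul_inv_cancel, one_mul, ρ_mul_apply] at this
    obtain ⟨α, hα⟩ := hgal S hS ψ₁ ψ₂
    -- `α (g·x₀) = x₀`
    have hαg : (α.hom.hom.hom (X.obj.ρ g x₀) : X.obj.V) = x₀ := by
      have := congrArg (fun φ : S ⟶ X => (φ.hom.hom ((1 : G) : G ⧸ K) : X.obj.V)) hα
      simp only at this
      rw [comp_apply, hψ₁, hψ₂] at this
      exact this.symm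
    -- hence `g⁻¹·x₀ = α x₀`, which is fixed by `n ∈ H`
    have hginv : X.obj.ρ g⁻¹ x₀ = α.hom.hom.hom x₀ := by
      conv_lhs => rw [← hαg]
      rw [← hom_ρ, ρ_inv_apply]
    change X.obj.ρ (g * n * g⁻¹) x₀ = x₀
    rw [ρ_mul_apply, ρ_mul_apply, hginv, ← hom_ρ, (hHmem n).mp hn, ← hginv, ρ_apply_inv]
  -- the open normal subgroup and the isomorphism `X ≅ Π/H`
  let N : OpenNormalSubgroup G := { toSubgroup := H, isOpen' := hHopen, isNormal' := hnormal }
  refine ⟨N, ?_⟩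
  have hQ : IsConnectedObj (BTemp.quotientObj G hG N.toSubgroup N.isOpen') :=
    isConnectedObj_quotientObj hG _ _
  obtain ⟨f, hf⟩ := exists_hom_of_stabilizer_le (T₂ := BTemp.quotientObj G hG N.toSubgroup N.isOpen')
    x₀ (htr x₀) ((1 : G) : G ⧸ N.toSubgroup) fun k hk =>
      (quotientObj_ρ_one_eq_iff hG N.toSubgroup N.isOpen' k).mpr hk
  obtain ⟨f', hf'⟩ := exists_hom_quotientObj hG N.toSubgroup N.isOpen' (X := X) x₀ fun k hk => hk
  refine ⟨⟨f, f', ?_, ?_⟩⟩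
  · refine hom_eq_of_apply_eq hconn _ _ x₀ ?_
    rw [comp_apply, hf, hf', id_apply]
  · refine hom_eq_of_apply_eq hQ _ _ ((1 : G) : G ⧸ N.toSubgroup) ?_
    rw [comp_apply, hf', hf, id_apply]

/-- Conversely, every `Π/N` with `N` open normal — and hence every object isomorphic to one — is
Galois: for `S` connected with a point `s` and `ψ₁(s) = aN`, `ψ₂(s) = bN`, the right translation by
`c = b⁻¹a` is an automorphism `α` of `Π/N` with `α(ψ₂(s)) = ψ₁(s)`, so `ψ₁ = ψ₂ ≫ α` (maps out of a
connected object are determined by one value). [cite: MochizukiSemiAnbd2006, Rmk 3.1.3 p.34] -/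
theorem isGaloisObj_of_iso_quotientObj (hG : IsTempered G) (X : BTemp G) (N : OpenNormalSubgroup G)
    (e : X ≅ BTemp.quotientObj G hG N.toSubgroup N.isOpen') : IsGaloisObj X := by
  have hQ : IsConnectedObj (BTemp.quotientObj G hG N.toSubgroup N.isOpen') :=
    isConnectedObj_quotientObj hG _ _
  refine ⟨isConnectedObj_of_iso e hQ, fun S hS ψ₁ ψ₂ => ?_⟩
  obtain ⟨s⟩ := nonempty_of_isConnectedObj S hS
  obtain ⟨a, ha⟩ := QuotientGroup.mk_surjective (e.hom.hom.hom (ψ₁.hom.hom s) : G ⧸ N.toSubgroup)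
  obtain ⟨b, hb⟩ := QuotientGroup.mk_surjective (e.hom.hom.hom (ψ₂.hom.hom s) : G ⧸ N.toSubgroup)
  haveI : N.toSubgroup.Normal := N.isNormal'
  obtain ⟨τ, hτ⟩ := exists_aut_quotientObj hG N.toSubgroup N.isOpen' (b⁻¹ * a)
  refine ⟨e ≪≫ τ ≪≫ e.symm, ?_⟩
  refine hom_eq_of_apply_eq hS _ _ s ?_
  rw [comp_apply]
  change _ = (e.symm.hom.hom.hom (τ.hom.hom.hom (e.hom.hom.hom (ψ₂.hom.hom s))) : X.obj.V)
  rw [← hb, ← quotientObj_ρ_one hG N.toSubgroup N.isOpen' b, hom_ρ, hτ, quotientObj_ρ_mk,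
    ← mul_assoc, mul_inv_cancel, one_mul, ha, Iso.symm_hom, iso_inv_hom_apply]


end GaloisObjects

open GaloisObjects in
/-- **[SemiAnbd] Remark 3.1.3, first sentence — DISCHARGED** (named fact
`GaloisObjIffQuotientOpenNormal` of `Temperoids.lean`): for `Π` tempered, an object of `B^temp(Π)`
is Galois iff it is isomorphic to some `Π/N`, `N ⊆ Π` open normal.
[cite: MochizukiSemiAnbd2006, Rmk 3.1.3 p.34] -/
theorem GaloisObjIffQuotientOpenNormal_holds :
    ∀ (G : Type u) [Group G] [TopologicalSpace G] [IsTopologicalGroup G],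
      GaloisObjIffQuotientOpenNormal G := fun _ _ _ _ hG X =>
  ⟨exists_iso_quotientObj_of_isGaloisObj hG X, fun ⟨N, ⟨e⟩⟩ => isGaloisObj_of_iso_quotientObj hG X N e⟩

end Literature.AnabelianGeometry.SemiGraphs
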